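import Mathlib
import Summits.NavierStokesRegularity.NavierStokesRegularity.Theorems.LevelSetModerationLevelSetEnergyInequalityTruncation
import Literature.Analysis.FluidPDE.SobolevWholeSpace
import Literature.Analysis.FluidPDE.MultiplicativeInequality

/-!
# Route LevelSetModeration — crux 3 `LevelSetClosure`: the two-level slice gain (helper file)

Support lemmas for item stmt-NavierStokesRegularity-18150
(`Summit.NavierStokesRegularity.NavierStokesRegularity.Theses.LevelSetModeration.LevelSetClosure`),
the PDE-free measure-theoretic leaf of the De Giorgi iteration for the speed
(Vasseur 2007, §4; De Giorgi 1957), registered sub-goal `sliceVolumeGain` of the item: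

* `exists_truncation` — the two-level `C¹` truncation `w = √(δ² + (|v| − k)₊²) − δ` of the speed
  of a `C¹` field (`0 ≤ w`, `w² ≤ (|v| − k)₊²`, `w ≥ (h−k)/4` on `{|v| > h}`,
  `|∇w| ≤ 1_{|v|>k}|∇|v||`);
* `sliceVolumeGain` — the two-level Chebyshev–Sobolev gain for ONE slice:
  `|{|v| > h}| ≤ (4/(h−k))^{10/3} K² (∫(|v|−k)₊²)^{2/3} ∫ 1_{|v|>k}|∇|v||²` for `v ∈ C¹ ∩ L²(ℝ³)`,
  `0 < k < h`, `K = SNormLESNormFDerivOfEqConst ℝ volume 2` (Chebyshev on `L^{10/3}`, Hölder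
  `10/3 = (2/5)·2 ⊕ (3/5)·6`, whole-space GNS `eLpNorm_six_le_eLpNorm_fderiv_two`);
* `levelVolume_twoLevel_le` — the same gain integrated over `τ ∈ (0,T)` for a field with
  `C¹ ∩ L²` slices: `V(h) ≤ (4/(h−k))^{10/3} K² S^{2/3} D(k)` (real-valued form).

## References
* A. Vasseur, *A new proof of partial regularity of solutions to Navier–Stokes equations*,
  NoDEA 14 (2007), §4. [Vasseur2007]
* L. C. Evans, *Partial Differential Equations*, §5.6.1 (GNS).
-/

noncomputable section

-- single-conjunct summit: `Summit.<Summit>.<Problem>` repeats the name by the D-0017 layout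
set_option linter.dupNamespace false

namespace Summit.NavierStokesRegularity.NavierStokesRegularity.Theorems

open MeasureTheory Set Filter Topology Function
open scoped ENNReal NNReal
open Literature.Analysis.FluidPDE

/-! ### Leaf 1: truncation and the slice gain -/

open Summit.NavierStokesRegularity.NavierStokesRegularity.Theorems.LevelSetEnergyInequality in
/-- The derivative of `x ↦ (|v(x)| − k)₊²` for a `C¹` field `v` and `k > 0`:
`D[(|v| − k)₊²](x) = 2 (|v(x)| − k)₊ D|v|(x)` (chain rule off the zero set of `v`; near a zero of
`v` both sides vanish, `|v| < k` there). [folklore] -/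
theorem fderiv_truncSq_comp {v : EuclideanSpace ℝ (Fin 3) → EuclideanSpace ℝ (Fin 3)}
    (hv : ContDiff ℝ 1 v) {k : ℝ} (hk : 0 < k) (x : EuclideanSpace ℝ (Fin 3)) :
    HasFDerivAt (fun y => (max (‖v y‖ - k) 0) ^ 2)
      ((2 * max (‖v x‖ - k) 0) • fderiv ℝ (fun y => ‖v y‖) x) x := by
  rcases eq_or_ne (v x) 0 with hx | hx
  · -- locally zero
    have hcont : ContinuousAt v x := hv.continuous.continuousAt
    have hev : (fun y => (max (‖v y‖ - k) 0) ^ 2) =ᶠ[𝓝 x] fun _ => (0 : ℝ) := by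
      have : ∀ᶠ y in 𝓝 x, ‖v y‖ < k := by
        have h1 : ∀ᶠ y in 𝓝 x, v y ∈ Metric.ball (0 : EuclideanSpace ℝ (Fin 3)) k := by
          apply hcont.preimage_mem_nhds
          rw [hx]; exact Metric.ball_mem_nhds _ hk
        filter_upwards [h1] with y hy
        simpa using hy
      filter_upwards [this] with y hy
      rw [max_eq_right (by linarith), zero_pow two_ne_zero]
    rw [hx, norm_zero, max_eq_right (by linarith), mul_zero, zero_smul]
    exact (hasFDerivAt_const (0 : ℝ) x).congr_of_eventuallyEq hev
  · have hn : DifferentiableAt ℝ (fun y => ‖v y‖) x :=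
      ((contDiffAt_norm (n := 1) ℝ hx).differentiableAt one_ne_zero).comp x
        (hv.differentiable one_ne_zero x)
    exact (hasDerivAt_posPart_sub_sq k ‖v x‖).comp_hasFDerivAt x hn.hasFDerivAt

open Summit.NavierStokesRegularity.NavierStokesRegularity.Theorems.LevelSetEnergyInequality in
/-- **Two-level `C¹` truncation of the speed.** For a `C¹` field `v` and levels `0 < k < h`, the
scalar `w = √(δ² + (|v| − k)₊²) − δ`, `δ = (h − k)/2`, is `C¹`, `0 ≤ w`, `w² ≤ (|v| − k)₊²`,
`w ≥ (h − k)/4` on `{|v| > h}`, and `|∇w| ≤ 1_{|v|>k} |∇|v||`. [folklore] -/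
theorem exists_truncation (v : EuclideanSpace ℝ (Fin 3) → EuclideanSpace ℝ (Fin 3)) (k h : ℝ)
    (hv : ContDiff ℝ 1 v) (hk : 0 < k) (hkh : k < h) :
    ∃ w : EuclideanSpace ℝ (Fin 3) → ℝ, ContDiff ℝ 1 w ∧ (∀ x, 0 ≤ w x) ∧
      (∀ x, w x ^ 2 ≤ (max (‖v x‖ - k) 0) ^ 2) ∧ (∀ x, h < ‖v x‖ → (h - k) / 4 ≤ w x) ∧
      (∀ x, ‖fderiv ℝ w x‖ ≤
        Set.indicator {x | k < ‖v x‖} (fun x => ‖fderiv ℝ (fun y => ‖v y‖) x‖) x) := by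
  set δ : ℝ := (h - k) / 2 with hδ
  have hδpos : 0 < δ := by rw [hδ]; linarith
  set Ψ : EuclideanSpace ℝ (Fin 3) → ℝ := fun y => (max (‖v y‖ - k) 0) ^ 2 with hΨ
  have hΨ0 : ∀ y, 0 ≤ Ψ y := fun y => sq_nonneg _
  have hF : ∀ y, 0 < δ ^ 2 + Ψ y := fun y => by positivity
  have hΨC1 : ContDiff ℝ 1 Ψ := (contDiff_one_truncSq hk).comp hv
  refine ⟨fun y => Real.sqrt (δ ^ 2 + Ψ y) - δ, ?_, ?_, ?_, ?_, ?_⟩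
  · -- `C¹`
    exact ((contDiff_const.add hΨC1).sqrt fun y => (hF y).ne').sub contDiff_const
  · -- `0 ≤ w`
    intro y
    have : δ ≤ Real.sqrt (δ ^ 2 + Ψ y) := by
      calc δ = Real.sqrt (δ ^ 2) := (Real.sqrt_sq hδpos.le).symm
        _ ≤ Real.sqrt (δ ^ 2 + Ψ y) := Real.sqrt_le_sqrt (by linarith [hΨ0 y])
    show 0 ≤ Real.sqrt (δ ^ 2 + Ψ y) - δ
    linarith
  · -- `w² ≤ (|v| − k)₊²`
    intro y
    set a := max (‖v y‖ - k) 0 with ha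
    have ha0 : 0 ≤ a := le_max_right _ _
    have h1 : Real.sqrt (δ ^ 2 + a ^ 2) ≤ a + δ := by
      rw [Real.sqrt_le_left (by positivity)]
      nlinarith
    have h2 : δ ≤ Real.sqrt (δ ^ 2 + a ^ 2) := by
      calc δ = Real.sqrt (δ ^ 2) := (Real.sqrt_sq hδpos.le).symm
        _ ≤ Real.sqrt (δ ^ 2 + a ^ 2) := Real.sqrt_le_sqrt (by nlinarith)
    have h3 : 0 ≤ Real.sqrt (δ ^ 2 + a ^ 2) - δ := by linarith
    show (Real.sqrt (δ ^ 2 + a ^ 2) - δ) ^ 2 ≤ a ^ 2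
    exact pow_le_pow_left₀ h3 (by linarith) 2
  · -- lower bound on `{|v| > h}`
    intro y hy
    have ha : 2 * δ < max (‖v y‖ - k) 0 := by
      rw [hδ]; exact lt_max_of_lt_left (by linarith)
    have h1 : max (‖v y‖ - k) 0 ≤ Real.sqrt (δ ^ 2 + Ψ y) := by
      calc max (‖v y‖ - k) 0 = Real.sqrt (Ψ y) := by
            rw [hΨ]; exact (Real.sqrt_sq (le_max_right _ _)).symm
        _ ≤ Real.sqrt (δ ^ 2 + Ψ y) := Real.sqrt_le_sqrt (by nlinarith)
    show (h - k) / 4 ≤ Real.sqrt (δ ^ 2 + Ψ y) - δ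
    rw [hδ] at ha h1 ⊢
    linarith
  · -- gradient bound
    intro y
    have hΨ' : HasFDerivAt Ψ ((2 * max (‖v y‖ - k) 0) • fderiv ℝ (fun z => ‖v z‖) y) y :=
      fderiv_truncSq_comp hv hk y
    have hF' : HasFDerivAt (fun z => δ ^ 2 + Ψ z)
        ((2 * max (‖v y‖ - k) 0) • fderiv ℝ (fun z => ‖v z‖) y) y := hΨ'.const_add (δ ^ 2)
    have hw' := (hF'.sqrt (hF y).ne').sub_const δ
    rw [hw'.fderiv, smul_smul, norm_smul, Real.norm_eq_abs]
    set a := max (‖v y‖ - k) 0 with ha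
    have ha0 : 0 ≤ a := le_max_right _ _
    have hsqrt_pos : 0 < Real.sqrt (δ ^ 2 + Ψ y) := Real.sqrt_pos.2 (hF y)
    have hcoef : |1 / (2 * Real.sqrt (δ ^ 2 + Ψ y)) * (2 * a)| = a / Real.sqrt (δ ^ 2 + Ψ y) := by
      rw [abs_of_nonneg (by positivity)]
      field_simp
    rw [hcoef]
    by_cases hyk : k < ‖v y‖
    · rw [indicator_of_mem (show y ∈ {x | k < ‖v x‖} from hyk)]
      have hle1 : a / Real.sqrt (δ ^ 2 + Ψ y) ≤ 1 := by
        rw [div_le_one hsqrt_pos]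
        calc a = Real.sqrt (a ^ 2) := (Real.sqrt_sq ha0).symm
          _ ≤ Real.sqrt (δ ^ 2 + Ψ y) := Real.sqrt_le_sqrt (by rw [hΨ]; nlinarith)
      calc a / Real.sqrt (δ ^ 2 + Ψ y) * ‖fderiv ℝ (fun z => ‖v z‖) y‖
          ≤ 1 * ‖fderiv ℝ (fun z => ‖v z‖) y‖ :=
            mul_le_mul_of_nonneg_right hle1 (norm_nonneg _)
        _ = ‖fderiv ℝ (fun z => ‖v z‖) y‖ := one_mul _
    · rw [indicator_of_notMem (show y ∉ {x | k < ‖v x‖} from hyk)]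
      have : a = 0 := by rw [ha]; exact max_eq_right (by linarith [not_lt.1 hyk])
      rw [this, zero_div, zero_mul]

open Summit.NavierStokesRegularity.NavierStokesRegularity.Theorems.LevelSetEnergyInequality in
/-- **Slice volume gain.** For a `C¹` square-integrable field `v` on `ℝ³` and levels `0 < k < h`:
`|{|v| > h}| ≤ (4/(h−k))^{10/3} K² (∫(|v|−k)₊²)^{2/3} ∫ 1_{|v|>k} |∇|v||²`,
`K = SNormLESNormFDerivOfEqConst ℝ volume 2` (two-level `C¹` truncation of the speed, Chebyshev
on `L^{10/3}`, Hölder interpolation and the whole-space Gagliardo–Nirenberg–Sobolev inequality).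
[folklore] -/
theorem sliceVolumeGain :
    ∀ (v : EuclideanSpace ℝ (Fin 3) → EuclideanSpace ℝ (Fin 3)) (k h : ℝ), ContDiff ℝ 1 v →
      MeasureTheory.MemLp v 2 MeasureTheory.volume → 0 < k → k < h →
      MeasureTheory.volume {x | h < ‖v x‖} ≤
        ENNReal.ofReal ((4 / (h - k)) ^ (10 / 3 : ℝ)) *
          (MeasureTheory.SNormLESNormFDerivOfEqConst ℝ
              (MeasureTheory.volume : MeasureTheory.Measure (EuclideanSpace ℝ (Fin 3))) 2 :
              ENNReal) ^ 2 *
          (∫⁻ x, ENNReal.ofReal ((max (‖v x‖ - k) 0) ^ 2)) ^ (2 / 3 : ℝ) *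
          ∫⁻ x, Set.indicator {x | k < ‖v x‖}
            (fun x => ENNReal.ofReal (‖fderiv ℝ (fun y => ‖v y‖) x‖ ^ 2)) x := by
  intro v k h hv hv2 hk hkh
  obtain ⟨w, hwC1, hw0, hwsq, hwlow, hwgrad⟩ := exists_truncation v k h hv hk hkh
  set Kc : ℝ≥0 := SNormLESNormFDerivOfEqConst ℝ (volume : Measure (EuclideanSpace ℝ (Fin 3))) 2
    with hKc
  have hw_meas : AEStronglyMeasurable w volume := hwC1.continuous.aestronglyMeasurable
  -- `w ∈ L²`
  have hw_le : ∀ x, ‖w x‖ ≤ ‖v x‖ := fun x => by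
    rw [Real.norm_eq_abs, abs_of_nonneg (hw0 x)]
    have h1 : w x ^ 2 ≤ ‖v x‖ ^ 2 := (hwsq x).trans (truncSq_le_norm_sq hk (v x))
    exact (pow_le_pow_iff_left₀ (hw0 x) (norm_nonneg _) two_ne_zero).1 h1
  have hw2 : eLpNorm w 2 volume < ∞ :=
    (eLpNorm_mono fun x => hw_le x).trans_lt hv2.eLpNorm_lt_top
  -- GNS and interpolation
  have hGNS := eLpNorm_six_le_eLpNorm_fderiv_two volume finrank_euclideanSpace_fin hwC1 hw2
  have hinterp := lintegral_enorm_rpow_ten_thirds_le (μ := volume) hw_meas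
  -- `(∫ |w|⁶)^{1/3} = ‖w‖₆²` and `‖Dw‖₂² = ∫ |Dw|²`
  have h6 : (∫⁻ x, ‖w x‖ₑ ^ (6:ℝ)) ^ (1 / 3 : ℝ) = eLpNorm w 6 volume ^ 2 := by
    rw [eLpNorm_eq_lintegral_rpow_enorm_toReal (by norm_num) (by norm_num),
      ← ENNReal.rpow_natCast, ← ENNReal.rpow_mul]
    norm_num
  have hD2 : eLpNorm (fderiv ℝ w) 2 volume ^ 2 = ∫⁻ x, ‖fderiv ℝ w x‖ₑ ^ (2:ℝ) := by
    rw [eLpNorm_eq_lintegral_rpow_enorm_toReal (by norm_num) (by norm_num),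
      ← ENNReal.rpow_natCast, ← ENNReal.rpow_mul]
    norm_num
  have hgrad_int : ∫⁻ x, ‖fderiv ℝ w x‖ₑ ^ (2:ℝ) ≤
      ∫⁻ x, {x | k < ‖v x‖}.indicator
        (fun x => ENNReal.ofReal (‖fderiv ℝ (fun y => ‖v y‖) x‖ ^ 2)) x := by
    refine lintegral_mono fun x => ?_
    have h1 := hwgrad x
    rw [← ofReal_norm, ENNReal.ofReal_rpow_of_nonneg (norm_nonneg _) (by norm_num),
      Real.rpow_two]
    by_cases hx : x ∈ {x | k < ‖v x‖}
    · rw [indicator_of_mem hx] at h1 ⊢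
      exact ENNReal.ofReal_le_ofReal (pow_le_pow_left₀ (norm_nonneg _) h1 2)
    · rw [indicator_of_notMem hx] at h1 ⊢
      have : ‖fderiv ℝ w x‖ = 0 := le_antisymm h1 (norm_nonneg _)
      simp [this]
  have hw2int : ∫⁻ x, ‖w x‖ₑ ^ (2:ℝ) ≤ ∫⁻ x, ENNReal.ofReal ((max (‖v x‖ - k) 0) ^ 2) := by
    refine lintegral_mono fun x => ?_
    rw [← ofReal_norm, ENNReal.ofReal_rpow_of_nonneg (norm_nonneg _) (by norm_num),
      Real.rpow_two, Real.norm_eq_abs, sq_abs]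
    exact ENNReal.ofReal_le_ofReal (hwsq x)
  -- `(∫ |w|⁶)^{1/3} ≤ K² ∫ 1_{|v|>k} |∇|v||²`
  have h6le : (∫⁻ x, ‖w x‖ₑ ^ (6:ℝ)) ^ (1 / 3 : ℝ) ≤ (Kc : ℝ≥0∞) ^ 2 *
      ∫⁻ x, {x | k < ‖v x‖}.indicator
        (fun x => ENNReal.ofReal (‖fderiv ℝ (fun y => ‖v y‖) x‖ ^ 2)) x := by
    rw [h6]
    calc eLpNorm w 6 volume ^ 2 ≤ ((Kc : ℝ≥0∞) * eLpNorm (fderiv ℝ w) 2 volume) ^ 2 := by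
          gcongr
      _ = (Kc : ℝ≥0∞) ^ 2 * ∫⁻ x, ‖fderiv ℝ w x‖ₑ ^ (2:ℝ) := by rw [mul_pow, hD2]
      _ ≤ _ := by gcongr
  -- Chebyshev on `L^{10/3}` for `w`
  have hhk : 0 < h - k := by linarith
  have hcheb : volume {x | h < ‖v x‖} ≤
      ENNReal.ofReal ((4 / (h - k)) ^ (10 / 3 : ℝ)) * ∫⁻ x, ‖w x‖ₑ ^ (10 / 3 : ℝ) := by
    set ε : ℝ≥0∞ := ENNReal.ofReal (((h - k) / 4) ^ (10 / 3 : ℝ)) with hε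
    have hεpos : 0 < ((h - k) / 4) ^ (10 / 3 : ℝ) := Real.rpow_pos_of_pos (by positivity) _
    have hε0 : ε ≠ 0 := by rw [hε]; exact ENNReal.ofReal_ne_zero_iff.2 hεpos
    have hsub : {x | h < ‖v x‖} ⊆ {x | ε ≤ ‖w x‖ₑ ^ (10 / 3 : ℝ)} := by
      intro x hx
      have hwx : (h - k) / 4 ≤ w x := hwlow x hx
      show ε ≤ ‖w x‖ₑ ^ (10 / 3 : ℝ)
      rw [hε, ← ofReal_norm, ENNReal.ofReal_rpow_of_nonneg (norm_nonneg _) (by norm_num),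
        Real.norm_eq_abs, abs_of_nonneg (hw0 x)]
      exact ENNReal.ofReal_le_ofReal (Real.rpow_le_rpow (by positivity) hwx (by norm_num))
    have hmeas : AEMeasurable (fun x => ‖w x‖ₑ ^ (10 / 3 : ℝ)) volume :=
      hw_meas.enorm.pow_const _
    calc volume {x | h < ‖v x‖} ≤ volume {x | ε ≤ ‖w x‖ₑ ^ (10 / 3 : ℝ)} := measure_mono hsub
      _ ≤ (∫⁻ x, ‖w x‖ₑ ^ (10 / 3 : ℝ)) / ε :=
          meas_ge_le_lintegral_div hmeas hε0 ENNReal.ofReal_ne_top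
      _ = ENNReal.ofReal ((4 / (h - k)) ^ (10 / 3 : ℝ)) * ∫⁻ x, ‖w x‖ₑ ^ (10 / 3 : ℝ) := by
          rw [div_eq_mul_inv, mul_comm, hε, ← ENNReal.ofReal_inv_of_pos hεpos,
            ← Real.inv_rpow (by positivity), inv_div]
  -- combine
  calc volume {x | h < ‖v x‖}
      ≤ ENNReal.ofReal ((4 / (h - k)) ^ (10 / 3 : ℝ)) * ∫⁻ x, ‖w x‖ₑ ^ (10 / 3 : ℝ) := hcheb
    _ ≤ ENNReal.ofReal ((4 / (h - k)) ^ (10 / 3 : ℝ)) *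
        ((∫⁻ x, ‖w x‖ₑ ^ (2:ℝ)) ^ (2 / 3 : ℝ) * (∫⁻ x, ‖w x‖ₑ ^ (6:ℝ)) ^ (1 / 3 : ℝ)) := by
        gcongr
    _ ≤ ENNReal.ofReal ((4 / (h - k)) ^ (10 / 3 : ℝ)) *
        ((∫⁻ x, ENNReal.ofReal ((max (‖v x‖ - k) 0) ^ 2)) ^ (2 / 3 : ℝ) *
          ((Kc : ℝ≥0∞) ^ 2 * ∫⁻ x, {x | k < ‖v x‖}.indicator
            (fun x => ENNReal.ofReal (‖fderiv ℝ (fun y => ‖v y‖) x‖ ^ 2)) x)) := by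
        gcongr
    _ = _ := by ring

/-! ### Time integration of the slice gain -/

/-- **Two-level step, integrated in time.** For a field `u` with `C¹`, square-integrable slices on
`(0,T)`, levels `0 < k < h`, a bound `S` on the truncated slice energies `∫(|u(τ)|−k)₊² ≤ S` and
finite level-set dissipation `D(k) = ∫₀ᵀ∫1_{|u|>k}|∇|u||² < ∞`:
`V(h) ≤ (4/(h−k))^{10/3} K² S^{2/3} D(k)` for the space–time volume `V(h)` of `{|u| > h}`
(slice gain integrated over `τ ∈ (0,T)`; Vasseur 2007, §4 / De Giorgi 1957). [folklore] -/
theorem levelVolume_twoLevel_le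
    {u : ℝ → EuclideanSpace ℝ (Fin 3) → EuclideanSpace ℝ (Fin 3)} {T k h S : ℝ}
    (hk : 0 < k) (hkh : k < h) (hS : 0 ≤ S)
    (hreg : ∀ τ ∈ Ioo 0 T, ContDiff ℝ 1 (u τ) ∧ MemLp (u τ) 2 volume)
    (hE : ∀ τ ∈ Ioo 0 T, ∫ x, (max (‖u τ x‖ - k) 0) ^ 2 ≤ S)
    (hD : (∫⁻ τ in Ioo 0 T, ∫⁻ x, {x | k < ‖u τ x‖}.indicator
        (fun x => ENNReal.ofReal (‖fderiv ℝ (fun y => ‖u τ y‖) x‖ ^ 2)) x) ≠ ∞) :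
    (∫⁻ τ in Ioo 0 T, volume {x | h < ‖u τ x‖}) ≠ ∞ ∧
    (∫⁻ τ in Ioo 0 T, volume {x | h < ‖u τ x‖}).toReal ≤
      (4 / (h - k)) ^ (10 / 3 : ℝ) *
        (SNormLESNormFDerivOfEqConst ℝ (volume : Measure (EuclideanSpace ℝ (Fin 3))) 2 : ℝ) ^ 2 *
        S ^ (2 / 3 : ℝ) *
        (∫⁻ τ in Ioo 0 T, ∫⁻ x, {x | k < ‖u τ x‖}.indicator
          (fun x => ENNReal.ofReal (‖fderiv ℝ (fun y => ‖u τ y‖) x‖ ^ 2)) x).toReal := by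
  set Kc : ℝ≥0 := SNormLESNormFDerivOfEqConst ℝ (volume : Measure (EuclideanSpace ℝ (Fin 3))) 2
    with hKc
  set g : ℝ → ℝ≥0∞ := fun τ => ∫⁻ x, {x | k < ‖u τ x‖}.indicator
      (fun x => ENNReal.ofReal (‖fderiv ℝ (fun y => ‖u τ y‖) x‖ ^ 2)) x with hg
  set A : ℝ≥0∞ := ENNReal.ofReal ((4 / (h - k)) ^ (10 / 3 : ℝ)) * (Kc : ℝ≥0∞) ^ 2 *
      ENNReal.ofReal S ^ (2 / 3 : ℝ) with hA
  have hA_ne : A ≠ ∞ := by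
    refine ENNReal.mul_ne_top (ENNReal.mul_ne_top ENNReal.ofReal_ne_top ?_) ?_
    · exact ENNReal.pow_ne_top ENNReal.coe_ne_top
    · exact ENNReal.rpow_ne_top_of_nonneg (by norm_num) ENNReal.ofReal_ne_top
  -- slice bound
  have hslice : ∀ τ ∈ Ioo 0 T, volume {x | h < ‖u τ x‖} ≤ A * g τ := by
    intro τ hτ
    obtain ⟨hc1, hm2⟩ := hreg τ hτ
    have h1 := sliceVolumeGain (u τ) k h hc1 hm2 hk hkh
    have hint : Integrable (fun x => (max (‖u τ x‖ - k) 0) ^ 2) volume := by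
      refine (hm2.integrable_norm_pow two_ne_zero).mono' ?_ (ae_of_all _ fun x => ?_)
      · exact ((hc1.continuous.norm.sub continuous_const).max continuous_const).pow 2
          |>.aestronglyMeasurable
      · have h0 : 0 ≤ max (‖u τ x‖ - k) 0 := le_max_right _ _
        have h1 : max (‖u τ x‖ - k) 0 ≤ ‖u τ x‖ :=
          max_le (by linarith [norm_nonneg (u τ x)]) (norm_nonneg _)
        rw [Real.norm_eq_abs, abs_of_nonneg (sq_nonneg _)]
        exact pow_le_pow_left₀ h0 h1 2
    have h2 : ∫⁻ x, ENNReal.ofReal ((max (‖u τ x‖ - k) 0) ^ 2) ≤ ENNReal.ofReal S := by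
      rw [← ofReal_integral_eq_lintegral_ofReal hint (ae_of_all _ fun x => sq_nonneg _)]
      exact ENNReal.ofReal_le_ofReal (hE τ hτ)
    calc volume {x | h < ‖u τ x‖} ≤ _ := h1
      _ ≤ A * g τ := by
          simp only [hA, hg]
          gcongr
  -- integrate over `(0,T)`
  have hV : (∫⁻ τ in Ioo 0 T, volume {x | h < ‖u τ x‖}) ≤ A * ∫⁻ τ in Ioo 0 T, g τ := by
    calc (∫⁻ τ in Ioo 0 T, volume {x | h < ‖u τ x‖}) ≤ ∫⁻ τ in Ioo 0 T, A * g τ := by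
          refine lintegral_mono_ae ?_
          filter_upwards [ae_restrict_mem measurableSet_Ioo] with τ hτ using hslice τ hτ
      _ = A * ∫⁻ τ in Ioo 0 T, g τ := lintegral_const_mul' _ _ hA_ne
  have hfin : A * ∫⁻ τ in Ioo 0 T, g τ ≠ ∞ := ENNReal.mul_ne_top hA_ne hD
  refine ⟨ne_top_of_le_ne_top hfin hV, ?_⟩
  have hAreal : A.toReal = (4 / (h - k)) ^ (10 / 3 : ℝ) * (Kc : ℝ) ^ 2 * S ^ (2 / 3 : ℝ) := by
    have h4 : 0 ≤ (4 / (h - k)) ^ (10 / 3 : ℝ) := by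
      apply Real.rpow_nonneg; exact div_nonneg (by norm_num) (by linarith)
    simp only [hA, ENNReal.toReal_mul, ENNReal.toReal_ofReal h4, ENNReal.toReal_pow,
      ENNReal.coe_toReal, ← ENNReal.toReal_rpow, ENNReal.toReal_ofReal hS]
  have := ENNReal.toReal_mono hfin hV
  rw [ENNReal.toReal_mul, hAreal] at this
  exact this


end Summit.NavierStokesRegularity.NavierStokesRegularity.Theorems

end
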